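import Mathlib.Analysis.SpecialFunctions.Trigonometric.Basic

/-!
# Three-term port sum: the scalar inequality implies antitonicity on `[0, 3/2]`

For nonnegative port masses `m₀, m₁, m₂` the squared modulus of the three-term port sum at a
boundary-adjacent target is

`Q(s) = m₀² + m₁² + m₂² + 2 (m₀ m₁ + m₁ m₂) cos (2π s / 3) + 2 m₀ m₂ cos (4π s / 3)`.

We show that `4 m₀ m₂ ≤ m₁ (m₀ + m₂)` forces `Q` to be antitone on `[0, 3/2]`.

Proof (derivative-free). With `c := cos (2π s / 3)` one has `cos (4π s / 3) = 2 c² - 1`, so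
`Q(s) = g(c)` for the quadratic `g(c) = (const) + 2 (m₀ m₁ + m₁ m₂) c + 4 m₀ m₂ c²`, which is
monotone on `[-1, 1]` under the inequality; and `s ↦ cos (2π s / 3)` is antitone on `[0, 3/2]`
(the angle runs through `[0, π]`).
-/

noncomputable section

namespace Summit.CriticalPhenomena.SAWScalingLimit.Cruxes.SpinMonotone.AdjacentPort

/-- Monotonicity of the quadratic `c ↦ 2 (m₀ m₁ + m₁ m₂) c + 2 m₀ m₂ (2 c² - 1)` on `[-1, ∞)`
under `4 m₀ m₂ ≤ m₁ (m₀ + m₂)`: the difference at `c₁ ≤ c₂` factors as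
`(c₂ - c₁) (2 m₁ (m₀ + m₂) + 4 m₀ m₂ (c₁ + c₂)) ≥ (c₂ - c₁) (2 m₁ (m₀ + m₂) - 8 m₀ m₂) ≥ 0`. -/
private theorem threeTerm_quad_mono {m₀ m₁ m₂ c₁ c₂ : ℝ} (h₀ : 0 ≤ m₀) (h₂ : 0 ≤ m₂)
    (hineq : 4 * m₀ * m₂ ≤ m₁ * (m₀ + m₂)) (hc₁ : -1 ≤ c₁) (hc₁₂ : c₁ ≤ c₂) :
    2 * (m₀ * m₁ + m₁ * m₂) * c₁ + 2 * (m₀ * m₂) * (2 * c₁ ^ 2 - 1) ≤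
      2 * (m₀ * m₁ + m₁ * m₂) * c₂ + 2 * (m₀ * m₂) * (2 * c₂ ^ 2 - 1) := by
  have hm : 0 ≤ m₀ * m₂ := mul_nonneg h₀ h₂
  have hd : 0 ≤ c₂ - c₁ := sub_nonneg.mpr hc₁₂
  have hc₂ : 0 ≤ c₂ + 1 := by linarith
  nlinarith [mul_nonneg hd (mul_nonneg hm (by linarith : (0 : ℝ) ≤ c₁ + 1)),
    mul_nonneg hd (mul_nonneg hm hc₂), mul_nonneg hd (sub_nonneg.mpr hineq)]

/-- `s ↦ cos (2π s / 3)` is antitone on `[0, 3/2]`: for `0 ≤ s ≤ t ≤ 3/2` the angles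
`2π s / 3 ≤ 2π t / 3` lie in `[0, π]`, where `cos` is antitone. -/
private theorem cos_twoPiDivThree_antitone {s t : ℝ} (hs : 0 ≤ s) (ht : t ≤ 3 / 2)
    (hst : s ≤ t) :
    Real.cos (2 * Real.pi * t / 3) ≤ Real.cos (2 * Real.pi * s / 3) := by
  have hπ : 0 < Real.pi := Real.pi_pos
  refine Real.cos_le_cos_of_nonneg_of_le_pi ?_ ?_ ?_
  · exact div_nonneg (mul_nonneg (mul_nonneg zero_le_two hπ.le) hs) (by norm_num)
  · nlinarith [mul_nonneg hπ.le (sub_nonneg.mpr ht)]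
  · nlinarith [mul_le_mul_of_nonneg_left hst hπ.le]

/-- S3 (converse real-analysis lemma). If `4 m₀ m₂ ≤ m₁ (m₀ + m₂)` for nonnegative masses, then
`Q(s) = m₀² + m₁² + m₂² + 2 (m₀ m₁ + m₁ m₂) cos (2π s / 3) + 2 m₀ m₂ cos (4π s / 3)` is antitone
on `[0, 3/2]`. Proof: `cos (4π s / 3) = 2 cos² (2π s / 3) - 1` turns `Q` into a quadratic in
`c = cos (2π s / 3)` that is monotone on `[-1, 1]` (`threeTerm_quad_mono`), composed with the
antitone map `s ↦ cos (2π s / 3)` on `[0, 3/2]` (`cos_twoPiDivThree_antitone`). -/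
theorem stub_threeTermAntitone : ∀ (m₀ m₁ m₂ : ℝ), 0 ≤ m₀ → 0 ≤ m₁ → 0 ≤ m₂ →
    4 * m₀ * m₂ ≤ m₁ * (m₀ + m₂) →
    AntitoneOn (fun s : ℝ => m₀ ^ 2 + m₁ ^ 2 + m₂ ^ 2 +
        2 * (m₀ * m₁ + m₁ * m₂) * Real.cos (2 * Real.pi * s / 3) +
        2 * (m₀ * m₂) * Real.cos (4 * Real.pi * s / 3)) (Set.Icc (0 : ℝ) (3 / 2)) := by
  intro m₀ m₁ m₂ h₀ _ h₂ hineq s hs t ht hst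
  have hcos2 : ∀ x : ℝ, Real.cos (4 * Real.pi * x / 3) =
      2 * Real.cos (2 * Real.pi * x / 3) ^ 2 - 1 := by
    intro x
    rw [← Real.cos_two_mul]
    congr 1
    ring
  simp only [hcos2]
  have hle : Real.cos (2 * Real.pi * t / 3) ≤ Real.cos (2 * Real.pi * s / 3) :=
    cos_twoPiDivThree_antitone hs.1 ht.2 hst
  have hc₁ : -1 ≤ Real.cos (2 * Real.pi * t / 3) := Real.neg_one_le_cos _
  have key := threeTerm_quad_mono (m₁ := m₁) h₀ h₂ hineq hc₁ hle
  linarith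

end Summit.CriticalPhenomena.SAWScalingLimit.Cruxes.SpinMonotone.AdjacentPort

end
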